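import Summits.Ventures.LatticeQCDFlow.Exactness.IMHCommonRandomNumbersPath
import Summits.Ventures.LatticeQCDFlow.Exactness.IMHGrandCouplingPath
import HarnessLib

/-!
# Common random numbers buy agreement, not precision: averaging runs that share their random numbers leaves at least
# the fraction `1 − r^b` of ONE run's mean-square error — no replica gain

HONEST FRAMING: exact (Metropolis-corrected) sampling algorithms for lattice gauge theory;
figures of merit are autocorrelation/cost numbers at stated couplings and volumes; no
continuum-physics claim.

Venture `LatticeQCDFlow` (cell pub-lqcd), topic `Exactness`; FANOUT row 30 (lean-1, GEN-36).  NEW WORK of the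
cell, general state space.  The path laws of `Exactness/IMHCommonRandomNumbersPath` (pairs) and
`Exactness/IMHGrandCouplingPath` (families) say that after `b` shared updates the coupled streams of
`K = indepMH q w` (`r = 1 − 1/w(x₀)`) ARE one equilibrium run recorded several times, with probability `1 − r^b`.
The flip side of this agreement, for a practitioner tempted to average coupled replicas:

* §1 **`crn_chain_integral_shift_ge_of_nonneg`** — THE LOWER ENVELOPE FOR NONNEGATIVE STATISTICS: for measurable
  `0 ≤ G ≤ M` on pair streams and every initial coupling, `E_{P̂}[G(Ẑ_{b+·})] ≥ (1 − r^b)·E_π[G(X, X)]`;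
  **`crn_chain_pairAverage_sq_ge`** — for a measurable path statistic `a ≤ F ≤ c` and ANY centre `m` (e.g. `π f`):
  `E[(½(F(X_{b+·}) + F(X′_{b+·})) − m)²] ≥ (1 − r^b)·E_π[(F − m)²]` — THE AVERAGE OF TWO COUPLED RUNS HAS AT LEAST
  `(1 − r^b)×` THE MEAN-SQUARE ERROR OF ONE EQUILIBRIUM RUN (two INDEPENDENT equilibrium runs: exactly half of it).
* §2 families: **`crnFamily_chain_integral_shift_ge_of_nonneg`**; **`crnFamily_chain_average_sq_ge`** — for a finite
  nonempty family, `E[((1/#ι)·Σ_i F(Z^i_{b+·}) − m)²] ≥ (1 − r^b)·E_π[(F − m)²]` — averaging ANY NUMBER of runs that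
  share their random numbers never beats one run by more than the factor `1 − r^b` (which tends to `1` with the
  burn-in), whereas `R` independent runs divide the equilibrium error by `R` (GEN-32/35 replica files).
Reading: shared random numbers are for COMPARING runs (burn-in diagnostics, sensitivity differences — previous files),
never for pooling them.
NOT CLAIMED: an upper bound on the pooled error beyond the single-run any-start bounds of GEN-35; anything about
partially shared streams.  No `sorry`, no new definitions, nothing cited as a fact.
-/

noncomputable section

namespace Summit.Ventures.LatticeQCDFlow.Exactness

open MeasureTheory ProbabilityTheory Function Set
open scoped ENNReal unitInterval
open Summit.Ventures.LatticeQCDFlow.Scoring Literature.Probability.MarkovChains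

variable {Ω : Type*} [MeasurableSpace Ω] {q : Measure Ω} [IsProbabilityMeasure q] {w : Ω → ℝ}

/-! ## §1 Pairs -/

/-- **THE LOWER ENVELOPE FOR NONNEGATIVE PATH STATISTICS (pairs)**: for measurable `0 ≤ G ≤ M` and every initial
coupling, `(1 − r^b)·E_π[G(n ↦ (X_n, X_n))] ≤ E_{P̂}[G(Ẑ_{b+·})]`. [ours] -/
theorem crn_chain_integral_shift_ge_of_nonneg [Fact (Measurable w)] (hw0 : ∀ y, 0 < w y) {x₀ : Ω}
    (hmax : ∀ y, w y ≤ w x₀) [IsProbabilityMeasure (q.withDensity fun y => ENNReal.ofReal (w y))]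
    (Khat : Kernel (Ω × Ω) (Ω × Ω)) [IsMarkovKernel Khat]
    (hK : ∀ z : Ω × Ω, Khat z = (q.prod (volume : Measure unitInterval)).map (fun p : Ω × unitInterval =>
      ((if (p.2 : ℝ) * w z.1 ≤ w p.1 then p.1 else z.1), (if (p.2 : ℝ) * w z.2 ≤ w p.1 then p.1 else z.2))))
    (μ₀ : Measure (Ω × Ω)) [IsProbabilityMeasure μ₀] (b : ℕ) {G : (ℕ → Ω × Ω) → ℝ} (hG : Measurable G) {M : ℝ}
    (hG0 : ∀ z, 0 ≤ G z) (hGM : ∀ z, G z ≤ M) :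
    (1 - (1 - (w x₀)⁻¹) ^ b) *
        ∫ x, G (fun n => (x n, x n)) ∂(Kernel.trajMeasure (X := fun _ : ℕ => Ω)
          (q.withDensity fun y => ENNReal.ofReal (w y))
          (fun n : ℕ => (indepMH q w).comap (fun h : (i : ↥(Finset.Iic n)) → Ω => h ⟨n, Finset.mem_Iic.2 le_rfl⟩)
            (measurable_pi_apply _))) ≤
      ∫ z, G (fun n => z (b + n)) ∂(Kernel.trajMeasure (X := fun _ : ℕ => Ω × Ω) μ₀
        (fun n : ℕ => Khat.comap (fun h : (i : ↥(Finset.Iic n)) → Ω × Ω => h ⟨n, Finset.mem_Iic.2 le_rfl⟩)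
          (measurable_pi_apply _))) := by
  obtain ⟨ν, hν, h⟩ := crn_chain_shift_anyCoupling_exists hw0 hmax Khat hK μ₀ b
  have hΘ : Measurable (fun (z : ℕ → Ω × Ω) (n : ℕ) => z (b + n)) :=
    measurable_pi_lambda _ fun n => measurable_pi_apply _
  have hD : Measurable (fun (x : ℕ → Ω) (n : ℕ) => (x n, x n)) :=
    measurable_pi_lambda _ fun n => (measurable_pi_apply n).prodMk (measurable_pi_apply n)
  have hW : 1 ≤ w x₀ := one_le_of_mode (q := q) hmax
  have hr0 : 0 ≤ 1 - (w x₀)⁻¹ := sub_nonneg.2 (inv_le_one_of_one_le₀ hW)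
  have hr1 : 1 - (w x₀)⁻¹ ≤ 1 := sub_le_self _ (inv_nonneg.mpr (hw0 x₀).le)
  have hc0 : 0 ≤ 1 - (1 - (w x₀)⁻¹) ^ b := sub_nonneg.2 (pow_le_one₀ hr0 hr1)
  have hGb : ∀ z, |G z| ≤ max |(0 : ℝ)| |M| := fun z => abs_le_max_abs_abs (hG0 z) (hGM z)
  have hGi : ∀ (m : Measure (ℕ → Ω × Ω)) [IsFiniteMeasure m], Integrable G m :=
    fun m _ => integrable_of_bounded m hG hGb
  have hmap : ∫ z, G (fun n => z (b + n)) ∂(Kernel.trajMeasure (X := fun _ : ℕ => Ω × Ω) μ₀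
        (fun n : ℕ => Khat.comap (fun h : (i : ↥(Finset.Iic n)) → Ω × Ω => h ⟨n, Finset.mem_Iic.2 le_rfl⟩)
          (measurable_pi_apply _))) =
      ∫ z, G z ∂((Kernel.trajMeasure (X := fun _ : ℕ => Ω × Ω) μ₀
        (fun n : ℕ => Khat.comap (fun h : (i : ↥(Finset.Iic n)) → Ω × Ω => h ⟨n, Finset.mem_Iic.2 le_rfl⟩)
          (measurable_pi_apply _))).map (fun (z : ℕ → Ω × Ω) (n : ℕ) => z (b + n))) :=
    (integral_map hΘ.aemeasurable hG.aestronglyMeasurable).symm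
  haveI : IsProbabilityMeasure (Kernel.trajMeasure (X := fun _ : ℕ => Ω × Ω) ν
      (fun n : ℕ => Khat.comap (fun h : (i : ↥(Finset.Iic n)) → Ω × Ω => h ⟨n, Finset.mem_Iic.2 le_rfl⟩)
        (measurable_pi_apply _))) := by infer_instance
  rw [hmap, h, integral_add_measure ((hGi _).smul_measure ENNReal.ofReal_ne_top)
      ((hGi _).smul_measure ENNReal.ofReal_ne_top), integral_smul_measure, integral_smul_measure,
    ENNReal.toReal_ofReal hc0, ENNReal.toReal_ofReal (pow_nonneg hr0 b), smul_eq_mul, smul_eq_mul,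
    integral_map hD.aemeasurable hG.aestronglyMeasurable]
  have hν0 : 0 ≤ ∫ z, G z ∂(Kernel.trajMeasure (X := fun _ : ℕ => Ω × Ω) ν
      (fun n : ℕ => Khat.comap (fun h : (i : ↥(Finset.Iic n)) → Ω × Ω => h ⟨n, Finset.mem_Iic.2 le_rfl⟩)
        (measurable_pi_apply _))) := integral_nonneg hG0
  nlinarith [pow_nonneg hr0 b]

/-- **NO REPLICA GAIN FOR A COUPLED PAIR**: for a measurable path statistic `a ≤ F ≤ c`, any centre `m` and every
initial coupling, `(1 − r^b)·E_π[(F − m)²] ≤ E[(½(F(X_{b+·}) + F(X′_{b+·})) − m)²]` — averaging the two runs that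
share their random numbers leaves at least the fraction `1 − r^b` of one equilibrium run's mean-square error. [ours] -/
theorem crn_chain_pairAverage_sq_ge [Fact (Measurable w)] (hw0 : ∀ y, 0 < w y) {x₀ : Ω} (hmax : ∀ y, w y ≤ w x₀)
    [IsProbabilityMeasure (q.withDensity fun y => ENNReal.ofReal (w y))]
    (Khat : Kernel (Ω × Ω) (Ω × Ω)) [IsMarkovKernel Khat]
    (hK : ∀ z : Ω × Ω, Khat z = (q.prod (volume : Measure unitInterval)).map (fun p : Ω × unitInterval =>
      ((if (p.2 : ℝ) * w z.1 ≤ w p.1 then p.1 else z.1), (if (p.2 : ℝ) * w z.2 ≤ w p.1 then p.1 else z.2))))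
    (μ₀ : Measure (Ω × Ω)) [IsProbabilityMeasure μ₀] (b : ℕ) {F : (ℕ → Ω) → ℝ} (hF : Measurable F) {a c : ℝ}
    (ha : ∀ x, a ≤ F x) (hc : ∀ x, F x ≤ c) (m : ℝ) :
    (1 - (1 - (w x₀)⁻¹) ^ b) *
        ∫ x, (F x - m) ^ 2 ∂(Kernel.trajMeasure (X := fun _ : ℕ => Ω) (q.withDensity fun y => ENNReal.ofReal (w y))
          (fun n : ℕ => (indepMH q w).comap (fun h : (i : ↥(Finset.Iic n)) → Ω => h ⟨n, Finset.mem_Iic.2 le_rfl⟩)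
            (measurable_pi_apply _))) ≤
      ∫ z, ((F (fun n => (z (b + n)).1) + F (fun n => (z (b + n)).2)) / 2 - m) ^ 2
        ∂(Kernel.trajMeasure (X := fun _ : ℕ => Ω × Ω) μ₀
          (fun n : ℕ => Khat.comap (fun h : (i : ↥(Finset.Iic n)) → Ω × Ω => h ⟨n, Finset.mem_Iic.2 le_rfl⟩)
            (measurable_pi_apply _))) := by
  -- the pair statistic `G(z) = (½(F(z¹) + F(z²)) − m)²`, nonnegative and bounded
  have h1m : Measurable (fun (z : ℕ → Ω × Ω) => F (fun n => (z n).1)) :=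
    hF.comp (measurable_pi_lambda _ fun n => measurable_fst.comp (measurable_pi_apply n))
  have h2m : Measurable (fun (z : ℕ → Ω × Ω) => F (fun n => (z n).2)) :=
    hF.comp (measurable_pi_lambda _ fun n => measurable_snd.comp (measurable_pi_apply n))
  have hG : Measurable (fun z : ℕ → Ω × Ω => ((F (fun n => (z n).1) + F (fun n => (z n).2)) / 2 - m) ^ 2) :=
    (((h1m.add h2m).div_const 2).sub_const m).pow_const 2
  set M : ℝ := max ((a - m) ^ 2) ((c - m) ^ 2) with hM
  have hbound : ∀ t : ℝ, a ≤ t → t ≤ c → (t - m) ^ 2 ≤ M := by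
    intro t hat htc
    rcases le_total t m with h | h
    · have h1 : (t - m) ^ 2 ≤ (a - m) ^ 2 := by nlinarith
      exact h1.trans (le_max_left _ _)
    · have h1 : (t - m) ^ 2 ≤ (c - m) ^ 2 := by nlinarith
      exact h1.trans (le_max_right _ _)
  have h := crn_chain_integral_shift_ge_of_nonneg hw0 hmax Khat hK μ₀ b hG (M := M) (fun z => sq_nonneg _)
    (fun z => by
      have h1 := ha (fun n => (z n).1); have h2 := hc (fun n => (z n).1)
      have h3 := ha (fun n => (z n).2); have h4 := hc (fun n => (z n).2)
      exact hbound _ (by linarith) (by linarith))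
  simp only [] at h
  rw [show (fun x : ℕ → Ω => ((F (fun n => x n) + F (fun n => x n)) / 2 - m) ^ 2) = fun x => (F x - m) ^ 2 from by
    funext x; ring] at h
  exact h

/-! ## §2 Families -/

/-- **THE LOWER ENVELOPE FOR NONNEGATIVE PATH STATISTICS (families)**: for measurable `0 ≤ G ≤ M` on family streams and
every initial coupling, `(1 − r^b)·E_π[G(n ↦ (i ↦ X_n))] ≤ E_{P̂}[G(Ẑ_{b+·})]`. [ours] -/
theorem crnFamily_chain_integral_shift_ge_of_nonneg {ι : Type*} [Fact (Measurable w)] (hw0 : ∀ y, 0 < w y) {x₀ : Ω}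
    (hmax : ∀ y, w y ≤ w x₀) [IsProbabilityMeasure (q.withDensity fun y => ENNReal.ofReal (w y))]
    (Khat : Kernel (ι → Ω) (ι → Ω)) [IsMarkovKernel Khat]
    (hK : ∀ z : ι → Ω, Khat z = (q.prod (volume : Measure unitInterval)).map
      (fun p : Ω × unitInterval => fun i : ι => if (p.2 : ℝ) * w (z i) ≤ w p.1 then p.1 else z i))
    (μ₀ : Measure (ι → Ω)) [IsProbabilityMeasure μ₀] (b : ℕ) {G : (ℕ → ι → Ω) → ℝ} (hG : Measurable G) {M : ℝ}
    (hG0 : ∀ z, 0 ≤ G z) (hGM : ∀ z, G z ≤ M) :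
    (1 - (1 - (w x₀)⁻¹) ^ b) *
        ∫ x, G (fun n _ => x n) ∂(Kernel.trajMeasure (X := fun _ : ℕ => Ω)
          (q.withDensity fun y => ENNReal.ofReal (w y))
          (fun n : ℕ => (indepMH q w).comap (fun h : (k : ↥(Finset.Iic n)) → Ω => h ⟨n, Finset.mem_Iic.2 le_rfl⟩)
            (measurable_pi_apply _))) ≤
      ∫ z, G (fun n => z (b + n)) ∂(Kernel.trajMeasure (X := fun _ : ℕ => ι → Ω) μ₀
        (fun n : ℕ => Khat.comap (fun h : (k : ↥(Finset.Iic n)) → (ι → Ω) => h ⟨n, Finset.mem_Iic.2 le_rfl⟩)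
          (measurable_pi_apply _))) := by
  obtain ⟨ν, hν, h⟩ := crnFamily_chain_shift_anyCoupling_exists hw0 hmax Khat hK μ₀ b
  have hΘ : Measurable (fun (z : ℕ → ι → Ω) (n : ℕ) => z (b + n)) :=
    measurable_pi_lambda _ fun n => measurable_pi_apply _
  have hD : Measurable (fun (x : ℕ → Ω) (n : ℕ) (_ : ι) => x n) :=
    measurable_pi_lambda _ fun n => measurable_pi_lambda _ fun _ => measurable_pi_apply n
  have hW : 1 ≤ w x₀ := one_le_of_mode (q := q) hmax
  have hr0 : 0 ≤ 1 - (w x₀)⁻¹ := sub_nonneg.2 (inv_le_one_of_one_le₀ hW)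
  have hr1 : 1 - (w x₀)⁻¹ ≤ 1 := sub_le_self _ (inv_nonneg.mpr (hw0 x₀).le)
  have hc0 : 0 ≤ 1 - (1 - (w x₀)⁻¹) ^ b := sub_nonneg.2 (pow_le_one₀ hr0 hr1)
  have hGb : ∀ z, |G z| ≤ max |(0 : ℝ)| |M| := fun z => abs_le_max_abs_abs (hG0 z) (hGM z)
  have hGi : ∀ (m : Measure (ℕ → ι → Ω)) [IsFiniteMeasure m], Integrable G m :=
    fun m _ => integrable_of_bounded m hG hGb
  have hmap : ∫ z, G (fun n => z (b + n)) ∂(Kernel.trajMeasure (X := fun _ : ℕ => ι → Ω) μ₀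
        (fun n : ℕ => Khat.comap (fun h : (k : ↥(Finset.Iic n)) → (ι → Ω) => h ⟨n, Finset.mem_Iic.2 le_rfl⟩)
          (measurable_pi_apply _))) =
      ∫ z, G z ∂((Kernel.trajMeasure (X := fun _ : ℕ => ι → Ω) μ₀
        (fun n : ℕ => Khat.comap (fun h : (k : ↥(Finset.Iic n)) → (ι → Ω) => h ⟨n, Finset.mem_Iic.2 le_rfl⟩)
          (measurable_pi_apply _))).map (fun (z : ℕ → ι → Ω) (n : ℕ) => z (b + n))) :=
    (integral_map hΘ.aemeasurable hG.aestronglyMeasurable).symm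
  haveI : IsProbabilityMeasure (Kernel.trajMeasure (X := fun _ : ℕ => ι → Ω) ν
      (fun n : ℕ => Khat.comap (fun h : (k : ↥(Finset.Iic n)) → (ι → Ω) => h ⟨n, Finset.mem_Iic.2 le_rfl⟩)
        (measurable_pi_apply _))) := by infer_instance
  rw [hmap, h, integral_add_measure ((hGi _).smul_measure ENNReal.ofReal_ne_top)
      ((hGi _).smul_measure ENNReal.ofReal_ne_top), integral_smul_measure, integral_smul_measure,
    ENNReal.toReal_ofReal hc0, ENNReal.toReal_ofReal (pow_nonneg hr0 b), smul_eq_mul, smul_eq_mul,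
    integral_map hD.aemeasurable hG.aestronglyMeasurable]
  have hν0 : 0 ≤ ∫ z, G z ∂(Kernel.trajMeasure (X := fun _ : ℕ => ι → Ω) ν
      (fun n : ℕ => Khat.comap (fun h : (k : ↥(Finset.Iic n)) → (ι → Ω) => h ⟨n, Finset.mem_Iic.2 le_rfl⟩)
        (measurable_pi_apply _))) := integral_nonneg hG0
  nlinarith [pow_nonneg hr0 b]

/-- **NO REPLICA GAIN FOR ANY NUMBER OF COUPLED RUNS**: for a finite nonempty family, a measurable path statistic
`a ≤ F ≤ c`, any centre `m` and every initial coupling,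
`(1 − r^b)·E_π[(F − m)²] ≤ E[((1/#ι)·Σ_i F(Z^i_{b+·}) − m)²]`. [ours] -/
theorem crnFamily_chain_average_sq_ge {ι : Type*} [Fintype ι] [Nonempty ι] [Fact (Measurable w)]
    (hw0 : ∀ y, 0 < w y) {x₀ : Ω} (hmax : ∀ y, w y ≤ w x₀)
    [IsProbabilityMeasure (q.withDensity fun y => ENNReal.ofReal (w y))]
    (Khat : Kernel (ι → Ω) (ι → Ω)) [IsMarkovKernel Khat]
    (hK : ∀ z : ι → Ω, Khat z = (q.prod (volume : Measure unitInterval)).map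
      (fun p : Ω × unitInterval => fun i : ι => if (p.2 : ℝ) * w (z i) ≤ w p.1 then p.1 else z i))
    (μ₀ : Measure (ι → Ω)) [IsProbabilityMeasure μ₀] (b : ℕ) {F : (ℕ → Ω) → ℝ} (hF : Measurable F) {a c : ℝ}
    (ha : ∀ x, a ≤ F x) (hc : ∀ x, F x ≤ c) (m : ℝ) :
    (1 - (1 - (w x₀)⁻¹) ^ b) *
        ∫ x, (F x - m) ^ 2 ∂(Kernel.trajMeasure (X := fun _ : ℕ => Ω) (q.withDensity fun y => ENNReal.ofReal (w y))
          (fun n : ℕ => (indepMH q w).comap (fun h : (k : ↥(Finset.Iic n)) → Ω => h ⟨n, Finset.mem_Iic.2 le_rfl⟩)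
            (measurable_pi_apply _))) ≤
      ∫ z, ((∑ i, F (fun n => z (b + n) i)) / Fintype.card ι - m) ^ 2
        ∂(Kernel.trajMeasure (X := fun _ : ℕ => ι → Ω) μ₀
          (fun n : ℕ => Khat.comap (fun h : (k : ↥(Finset.Iic n)) → (ι → Ω) => h ⟨n, Finset.mem_Iic.2 le_rfl⟩)
            (measurable_pi_apply _))) := by
  have hco : ∀ i : ι, Measurable (fun (z : ℕ → ι → Ω) => F (fun n => z n i)) := fun i =>
    hF.comp (measurable_pi_lambda _ fun n => (measurable_pi_apply i).comp (measurable_pi_apply n))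
  have hG : Measurable (fun z : ℕ → ι → Ω => ((∑ i, F (fun n => z n i)) / Fintype.card ι - m) ^ 2) :=
    (((Finset.measurable_sum _ fun i _ => hco i).div_const _).sub_const m).pow_const 2
  set M : ℝ := max ((a - m) ^ 2) ((c - m) ^ 2) with hM
  have hbound : ∀ t : ℝ, a ≤ t → t ≤ c → (t - m) ^ 2 ≤ M := by
    intro t hat htc
    rcases le_total t m with h | h
    · have h1 : (t - m) ^ 2 ≤ (a - m) ^ 2 := by nlinarith
      exact h1.trans (le_max_left _ _)
    · have h1 : (t - m) ^ 2 ≤ (c - m) ^ 2 := by nlinarith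
      exact h1.trans (le_max_right _ _)
  have hcard : (0 : ℝ) < Fintype.card ι := by exact_mod_cast Fintype.card_pos
  have havg : ∀ z : ℕ → ι → Ω, a ≤ (∑ i, F (fun n => z n i)) / Fintype.card ι ∧
      (∑ i, F (fun n => z n i)) / Fintype.card ι ≤ c := by
    intro z
    constructor
    · rw [le_div_iff₀ hcard, ← nsmul_eq_mul', ← Finset.card_univ, ← Finset.sum_const]
      exact Finset.sum_le_sum fun i _ => ha _
    · rw [div_le_iff₀ hcard, ← nsmul_eq_mul', ← Finset.card_univ, ← Finset.sum_const]
      exact Finset.sum_le_sum fun i _ => hc _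
  have h := crnFamily_chain_integral_shift_ge_of_nonneg hw0 hmax Khat hK μ₀ b hG (M := M) (fun z => sq_nonneg _)
    (fun z => hbound _ (havg z).1 (havg z).2)
  simp only [Finset.sum_const, Finset.card_univ, nsmul_eq_mul] at h
  rw [show (fun x : ℕ → Ω => ((Fintype.card ι : ℝ) * F (fun n => x n) / Fintype.card ι - m) ^ 2) =
      fun x => (F x - m) ^ 2 from by
    funext x
    rw [mul_div_cancel_left₀ _ hcard.ne']] at h
  exact h

end Summit.Ventures.LatticeQCDFlow.Exactness

end
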